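import Mathlib
import Summits.Ventures.DiscreteObjects.Mahler.FourTermMeasureBound
import Summits.Ventures.DiscreteObjects.Mahler.UnitMeasureFactors

/-!
# Sparse reciprocal polynomials III: cyclotomic factors of `x^{p+q} + b x^p + s b x^q + s`, `|b| ≥ 3`,
and the UNCONDITIONAL bound `M² ≥ |b|/2` (venture `DiscreteObjects`, target L)

Cell `pub-namedobj`, seat `pub-namedobj-mahler-g24`. Framing: lottery ticket; floor = certified
bounds/negative ranges.

For `P = x^{p+q} + b x^p + s b x^q + s` (`0 < p < q`, `s = ±1`, `k = q - p`, `n = p + q`) WITH cyclotomic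
factors allowed:

* `cyclotomic_dvd_X_pow_add_of_dvd_quadrinomial` — if `|b| ≥ 3` and `Φ_r ∣ P` then `Φ_r ∣ x^k + s`
  (norm argument: `Res(Φ_r, xⁿ + s) = (-bs)^{φ(r)} Res(Φ_r, x^p(x^k + s))` has modulus `≤ 2^{φ(r)}`, so the
  second resultant vanishes); hence also `Φ_r ∣ xⁿ + s` and `Φ_r ∣ x^{2p} - 1`
  (`cyclotomic_dvd_X_pow_sub_one_of_dvd_quadrinomial`);
* `eq_natAbs_mul_of_cyclotomic_sq_dvd_quadrinomial` — a REPEATED cyclotomic factor forces `n = |b|·k`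
  (differentiate: at a common root `ζ`, `b k ζ^p = -s n`);
* `exists_cyclotomicFree_factor_quadrinomial` — outside that thin family, `P = C · Q` with `Q`
  cyclotomic-free, `C ∣ x^k + s`, `C ∣ x^{2p} - 1` (so `deg C ≤ min(k, 2p) ≤ n/2`, `M(C) = 1`);
* `abs_le_two_mul_measure_sq_quadrinomial` — **`|b| ≤ 2 M(P)²`**, unconditionally, for `|b| ≥ 3` and
  `n ≠ |b| k`: the resultant step of `FourTermMeasureBound` applied to `Q` (`|b|^{deg Q} ≤ 2^{deg Q} Mⁿ`
  with `2 deg Q ≥ n`).  In particular `M(P) ≥ √(3/2) > 1.2247 > M(ℓ)`: such a quadrinomial is never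
  cyclotomic and never sub-Lehmer (`not_subLehmer_quadrinomial_of_three_le_abs`).

In print: [Dobrowolski2006] E. Dobrowolski, Acta Arith. 123 (2006) 201–231, Prop. 2 — "a monic quadrinomial
`f ∈ ℤ[x]`, `f(0) ≠ 0`, that is not a product of cyclotomic factors has `M(f) ≥ θ₀`" — whose proof (§5 there)
uses the same congruence `a ∣ α^{n+m} + η`, the same determination of the roots of unity among the zeros for
`a ≥ 3`, and the multiplicity bound `3`; this file is a kernel formalisation of that case (REPLICATION, the
statement here with the weaker conclusion `M² ≥ |b|/2`).  The cases `|b| = 2` and `n = |b| k` follow in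
`FourTermAbsTwoFactors` / `FourTermAbsTwo` / `FourTermSpecialFamily`.
-/

namespace Summit.Ventures.DiscreteObjects.Mahler

open Polynomial

section Quadrinomial

variable {p q : ℕ} {b s : ℤ}

/-- The quadrinomial rewritten around its "binomial core": with `W = x^{q-p} + s`,
`x^{p+q} + b x^p + s b x^q + s = (x^{p+q} + s) + (b s) · x^p · W` (uses `s² = 1`). -/
theorem quadrinomial_eq_core (hpq : p < q) (hs : s = 1 ∨ s = -1) (b : ℤ) :
    (X ^ (p + q) + C b * X ^ p + C (s * b) * X ^ q + C s : ℤ[X]) =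
      (X ^ (p + q) + C s) + C (b * s) * (X ^ p * (X ^ (q - p) + C s)) := by
  have hss : s * s = 1 := by rcases hs with h | h <;> simp [h]
  have hCs : (C s : ℤ[X]) * C s = 1 := by rw [← map_mul, hss, map_one]
  obtain ⟨k, rfl⟩ : ∃ k, q = p + k := ⟨q - p, by omega⟩
  rw [Nat.add_sub_cancel_left, map_mul, map_mul]
  linear_combination (-(C b * X ^ p)) * hCs

/-- **Cyclotomic factors of the quadrinomial, `|b| ≥ 3`.**  If `Φ_r ∣ P = x^{p+q} + b x^p + s b x^q + s`
with `|b| ≥ 3` (`0 < p < q`, `s = ±1`), then `Φ_r ∣ x^{q-p} + s`.  Proof: `P = Φ_r H`, so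
`xⁿ + s = (-bs) x^p W + Φ_r H` and `Res(Φ_r, xⁿ + s) = (-bs)^{φ(r)} Res(Φ_r, x^p W)`; the left side is
`∏_ζ (ζⁿ + s)` over the primitive `r`-th roots of unity, of modulus `≤ 2^{φ(r)} < 3^{φ(r)}`, so
`Res(Φ_r, x^p W) = 0`: some `ζ` is a root of `W`, and `Φ_r = minpoly(ζ) ∣ W`. -/
theorem cyclotomic_dvd_X_pow_add_of_dvd_quadrinomial (hp : 0 < p) (hpq : p < q) (hs : s = 1 ∨ s = -1)
    (hb : 3 ≤ |b|) {r : ℕ} (hr : 0 < r)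
    (hdvd : cyclotomic r ℤ ∣ (X ^ (p + q) + C b * X ^ p + C (s * b) * X ^ q + C s : ℤ[X])) :
    cyclotomic r ℤ ∣ (X ^ (q - p) + C s : ℤ[X]) := by
  set Φ : ℤ[X] := cyclotomic r ℤ with hΦ
  set n := p + q with hn
  have hΦm : Φ.Monic := cyclotomic.monic r ℤ
  have hΦ0 : Φ ≠ 0 := hΦm.ne_zero
  have hd : Φ.natDegree = r.totient := natDegree_cyclotomic r ℤ
  have hdpos : 0 < Φ.natDegree := by rw [hd]; exact Nat.totient_pos.mpr hr
  obtain ⟨H, hH⟩ := hdvd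
  have hH0 : H ≠ 0 := by
    intro h0
    have := (quadrinomial_monic_natDegree hp hpq b s).1.ne_zero
    rw [hH, h0, mul_zero] at this
    exact this rfl
  have hHdeg : H.natDegree + Φ.natDegree = n := by
    have h := (quadrinomial_monic_natDegree hp hpq b s).2
    rw [hH, natDegree_mul hΦ0 hH0] at h
    omega
  -- `xⁿ + s = C (-(b s)) * (X^p * W) + Φ * H`, `W = X^{q-p} + s`
  have hG : (X ^ n + C s : ℤ[X]) = C (-(b * s)) * (X ^ p * (X ^ (q - p) + C s)) + Φ * H := by
    rw [← hH, quadrinomial_eq_core hpq hs b, map_neg]; ring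
  have hGdeg : (X ^ n + C s : ℤ[X]).natDegree ≤ n := by rw [natDegree_X_pow_add_C]
  have hTdeg : (X ^ p * (X ^ (q - p) + C s) : ℤ[X]).natDegree ≤ n := by
    refine natDegree_mul_le.trans ?_
    rw [natDegree_X_pow, natDegree_X_pow_add_C]; omega
  -- the resultant identity
  have hres : Φ.resultant (X ^ n + C s) Φ.natDegree n =
      (-(b * s)) ^ Φ.natDegree * Φ.resultant (X ^ p * (X ^ (q - p) + C s)) Φ.natDegree n := by
    rw [hG, resultant_add_mul_right Φ (C (-(b * s)) * (X ^ p * (X ^ (q - p) + C s))) H Φ.natDegree n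
      (by omega) le_rfl, resultant_C_mul_right]
  -- upper bound `|Res(Φ, xⁿ + s)| ≤ 2^{φ(r)}` over `ℂ`
  have hinj : Function.Injective (Int.castRingHom ℂ) := (Int.castRingHom ℂ).injective_int
  have hcard : Multiset.card (Φ.map (Int.castRingHom ℂ)).roots = Φ.natDegree := by
    have hsp := (IsAlgClosed.splits (Φ.map (Int.castRingHom ℂ))).natDegree_eq_card_roots
    rw [natDegree_map_eq_of_injective hinj] at hsp
    exact hsp.symm
  have hlc : (Φ.map (Int.castRingHom ℂ)).leadingCoeff = 1 := by
    rw [leadingCoeff_map_of_injective hinj, hΦm.leadingCoeff, map_one]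
  have hrootΦ : ∀ ζ ∈ (Φ.map (Int.castRingHom ℂ)).roots, IsPrimitiveRoot ζ r := by
    intro ζ hζ
    have h := (mem_roots'.mp hζ).2
    rw [hΦ, map_cyclotomic] at h
    haveI : NeZero (r : ℂ) := ⟨by exact_mod_cast hr.ne'⟩
    exact isRoot_cyclotomic_iff.mp h
  have hup : ‖((Φ.resultant (X ^ n + C s) Φ.natDegree n : ℤ) : ℂ)‖ ≤ 2 ^ Φ.natDegree := by
    rw [resultant_intCast_eq hGdeg, hlc, one_pow, one_mul]
    have hmp := map_multiset_prod (normHom : ℂ →*₀ ℝ)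
      (((Φ.map (Int.castRingHom ℂ)).roots.map ((X ^ n + C s : ℤ[X]).map (Int.castRingHom ℂ)).eval))
    rw [Multiset.map_map] at hmp
    simp only [normHom_apply, Function.comp_def] at hmp
    rw [hmp]
    calc ((Φ.map (Int.castRingHom ℂ)).roots.map
          (fun ζ => ‖((X ^ n + C s : ℤ[X]).map (Int.castRingHom ℂ)).eval ζ‖)).prod
        ≤ ((Φ.map (Int.castRingHom ℂ)).roots.map (fun _ => (2 : ℝ))).prod := by
          refine Multiset.prod_map_le_prod_map₀ _ _ (fun ζ _ => norm_nonneg _) (fun ζ hζ => ?_)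
          simp only [Polynomial.map_add, Polynomial.map_pow, map_X, eq_intCast, Polynomial.map_intCast,
            eval_add, eval_pow, eval_X, eval_intCast]
          have h1 : ‖ζ‖ = 1 := (hrootΦ ζ hζ).norm'_eq_one hr.ne'
          calc ‖ζ ^ n + (s : ℂ)‖ ≤ ‖ζ ^ n‖ + ‖(s : ℂ)‖ := norm_add_le _ _
            _ ≤ 1 + 1 := add_le_add (by rw [norm_pow, h1, one_pow]) (norm_intCast_le_one_of_sign hs)
            _ = 2 := by norm_num
      _ = 2 ^ Φ.natDegree := by rw [Multiset.map_const', Multiset.prod_replicate, hcard]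
  -- hence `Res(Φ, x^p W) = 0`
  have hzero : Φ.resultant (X ^ p * (X ^ (q - p) + C s)) Φ.natDegree n = 0 := by
    by_contra hne
    have h1 : (1 : ℤ) ≤ |Φ.resultant (X ^ p * (X ^ (q - p) + C s)) Φ.natDegree n| := Int.one_le_abs hne
    have h3 : (3 : ℤ) ^ Φ.natDegree ≤ |Φ.resultant (X ^ n + C s) Φ.natDegree n| := by
      rw [hres, abs_mul, abs_pow, abs_neg, abs_mul]
      have hbs : (3 : ℤ) ≤ |b| * |s| := by rcases hs with h | h <;> simp [h, hb]
      calc (3 : ℤ) ^ Φ.natDegree = 3 ^ Φ.natDegree * 1 := by ring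
        _ ≤ (|b| * |s|) ^ Φ.natDegree * |Φ.resultant (X ^ p * (X ^ (q - p) + C s)) Φ.natDegree n| :=
            mul_le_mul (pow_le_pow_left₀ (by norm_num) hbs _) h1 (by norm_num) (by positivity)
    have h3R : (3 : ℝ) ^ Φ.natDegree ≤ ‖((Φ.resultant (X ^ n + C s) Φ.natDegree n : ℤ) : ℂ)‖ := by
      rw [Complex.norm_intCast]; exact_mod_cast h3
    have h23 : (2 : ℝ) ^ Φ.natDegree < 3 ^ Φ.natDegree := pow_lt_pow_left₀ (by norm_num) (by norm_num) hdpos.ne'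
    linarith
  -- a common root: some primitive `r`-th root of unity `ζ` with `ζ^p W(ζ) = 0`
  have hC := resultant_intCast_eq (f := Φ) hTdeg
  rw [hzero, Int.cast_zero, hlc, one_pow, one_mul] at hC
  obtain ⟨w, hw, hw0⟩ := Multiset.prod_eq_zero_iff.mp hC.symm |> Multiset.mem_map.mp
  have hζ := hrootΦ w hw
  have hw1 : ‖w‖ = 1 := hζ.norm'_eq_one hr.ne'
  have hwne : w ≠ 0 := fun h => by rw [h, norm_zero] at hw1; exact zero_ne_one hw1
  have hWw : aeval w (X ^ (q - p) + C s : ℤ[X]) = 0 := by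
    simp only [Polynomial.map_mul, Polynomial.map_pow, map_X, eval_mul, eval_pow, eval_X] at hw0
    rcases mul_eq_zero.mp hw0 with h | h
    · exact absurd (pow_eq_zero_iff (by omega) |>.mp h) hwne
    · rwa [eval_map, ← algebraMap_int_eq, ← aeval_def] at h
  rw [hΦ, cyclotomic_eq_minpoly hζ hr]
  exact minpoly.isIntegrallyClosed_dvd (hζ.isIntegral hr) hWw

/-- With `|b| ≥ 3`, a cyclotomic factor `Φ_r` of the quadrinomial also divides `x^{p+q} + s` and
`x^{2p} - 1` (from `Φ_r ∣ x^{q-p} + s` and `xⁿ + s - x^{2p}(x^{q-p} + s) = s(1 - x^{2p})`). -/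
theorem cyclotomic_dvd_X_pow_sub_one_of_dvd_quadrinomial (hp : 0 < p) (hpq : p < q) (hs : s = 1 ∨ s = -1)
    (hb : 3 ≤ |b|) {r : ℕ} (hr : 0 < r)
    (hdvd : cyclotomic r ℤ ∣ (X ^ (p + q) + C b * X ^ p + C (s * b) * X ^ q + C s : ℤ[X])) :
    cyclotomic r ℤ ∣ (X ^ (p + q) + C s : ℤ[X]) ∧ cyclotomic r ℤ ∣ (X ^ (2 * p) - 1 : ℤ[X]) := by
  have hW := cyclotomic_dvd_X_pow_add_of_dvd_quadrinomial hp hpq hs hb hr hdvd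
  have hss : s * s = 1 := by rcases hs with h | h <;> simp [h]
  have hCs : (C s : ℤ[X]) * C s = 1 := by rw [← map_mul, hss, map_one]
  have h1 : cyclotomic r ℤ ∣ (X ^ (p + q) + C s : ℤ[X]) := by
    have e : (X ^ (p + q) + C s : ℤ[X]) =
        (X ^ (p + q) + C b * X ^ p + C (s * b) * X ^ q + C s) - C (b * s) * X ^ p * (X ^ (q - p) + C s) := by
      rw [quadrinomial_eq_core hpq hs b]; ring
    rw [e]
    exact dvd_sub hdvd (dvd_mul_of_dvd_right hW _)
  refine ⟨h1, ?_⟩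
  have e2 : (X ^ (2 * p) - 1 : ℤ[X]) = C s * (X ^ (2 * p) * (X ^ (q - p) + C s) - (X ^ (p + q) + C s)) := by
    obtain ⟨k, rfl⟩ : ∃ k, q = p + k := ⟨q - p, by omega⟩
    rw [Nat.add_sub_cancel_left]
    linear_combination (1 - X ^ (2 * p) : ℤ[X]) * hCs
  rw [e2]
  exact dvd_mul_of_dvd_right (dvd_sub (dvd_mul_of_dvd_right hW _) h1) _

/-- **Repeated cyclotomic factors only in the family `n = |b| k`.**  If `Φ_r² ∣ P` (`|b| ≥ 3`) then
`p + q = |b| (q - p)`: at a primitive `r`-th root of unity `ζ` one has `ζ^{q-p} = -s`, `ζⁿ = -s`,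
`P'(ζ) = 0`, and `ζ P'(ζ) = n ζⁿ + b p ζ^p + s b q ζ^q = -s n - b (q - p) ζ^p`, so `|b| (q-p) = n`. -/
theorem eq_natAbs_mul_of_cyclotomic_sq_dvd_quadrinomial (hp : 0 < p) (hpq : p < q) (hs : s = 1 ∨ s = -1)
    (hb : 3 ≤ |b|) {r : ℕ} (hr : 0 < r)
    (hdvd : cyclotomic r ℤ * cyclotomic r ℤ ∣ (X ^ (p + q) + C b * X ^ p + C (s * b) * X ^ q + C s : ℤ[X])) :
    p + q = b.natAbs * (q - p) := by
  set Φ : ℤ[X] := cyclotomic r ℤ with hΦ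
  set P : ℤ[X] := X ^ (p + q) + C b * X ^ p + C (s * b) * X ^ q + C s with hP
  have hss : s * s = 1 := by rcases hs with h | h <;> simp [h]
  have hs2 : (s : ℂ) * s = 1 := by exact_mod_cast hss
  have hdvd1 : Φ ∣ P := dvd_trans (dvd_mul_right Φ Φ) hdvd
  have hW := cyclotomic_dvd_X_pow_add_of_dvd_quadrinomial hp hpq hs hb hr hdvd1
  have hV := (cyclotomic_dvd_X_pow_sub_one_of_dvd_quadrinomial hp hpq hs hb hr hdvd1).1
  -- a primitive r-th root of unity and the three vanishing statements
  set ζ : ℂ := Complex.exp (2 * Real.pi * Complex.I / r) with hζdef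
  have hprim : IsPrimitiveRoot ζ r := Complex.isPrimitiveRoot_exp r (by omega)
  have hζ1 : ‖ζ‖ = 1 := hprim.norm'_eq_one hr.ne'
  have hΦζ : aeval ζ Φ = 0 := by
    have h := hprim.isRoot_cyclotomic hr (R := ℂ)
    rw [IsRoot.def, ← map_cyclotomic_int, eval_map] at h
    rwa [aeval_def, algebraMap_int_eq]
  have aeval_of_dvd : ∀ {F : ℤ[X]}, Φ ∣ F → aeval ζ F = 0 := by
    intro F hF; obtain ⟨R, hR⟩ := hF; rw [hR, map_mul, hΦζ, zero_mul]
  have hk : ζ ^ (q - p) = -(s : ℂ) := by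
    have h := aeval_of_dvd hW
    simp only [map_add, map_pow, aeval_X, eq_intCast, map_intCast] at h
    exact eq_neg_of_add_eq_zero_left h
  have hnn : ζ ^ (p + q) = -(s : ℂ) := by
    have h := aeval_of_dvd hV
    simp only [map_add, map_pow, aeval_X, eq_intCast, map_intCast] at h
    exact eq_neg_of_add_eq_zero_left h
  have hq : ζ ^ q = -(s : ℂ) * ζ ^ p := by
    rw [show q = p + (q - p) by omega, pow_add, hk]; ring
  -- `Φ ∣ P'`
  have hder : Φ ∣ derivative P := by
    obtain ⟨R, hR⟩ := hdvd
    rw [hR, mul_assoc, derivative_mul]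
    exact dvd_add ((dvd_mul_right Φ R).mul_left _) (dvd_mul_right _ _)
  have hder' : derivative P = C ((p + q : ℕ) : ℤ) * X ^ (p + q - 1) + C (b * (p : ℤ)) * X ^ (p - 1) +
      C (s * b * (q : ℤ)) * X ^ (q - 1) := by
    rw [hP]
    simp only [derivative_add, derivative_X_pow, derivative_C_mul_X_pow, derivative_C, add_zero]
  have hE := aeval_of_dvd hder
  rw [hder'] at hE
  simp only [map_add, map_mul, map_pow, aeval_X, eq_intCast, map_intCast, map_natCast] at hE
  -- multiply by ζ
  have hE' : ((p + q : ℕ) : ℂ) * ζ ^ (p + q) + b * p * ζ ^ p + s * b * q * ζ ^ q = 0 := by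
    have e1 : ζ ^ (p + q) = ζ * ζ ^ (p + q - 1) := (mul_pow_sub_one (by omega) ζ).symm
    have e2 : ζ ^ p = ζ * ζ ^ (p - 1) := (mul_pow_sub_one (by omega) ζ).symm
    have e3 : ζ ^ q = ζ * ζ ^ (q - 1) := (mul_pow_sub_one (by omega) ζ).symm
    rw [e1, e2, e3]
    linear_combination ζ * hE
  rw [hnn, hq] at hE'
  have hkey : (b : ℂ) * ((q : ℂ) - p) * ζ ^ p = -((s : ℂ) * ((p + q : ℕ) : ℂ)) := by
    linear_combination (-1 : ℂ) * hE' + (-(b : ℂ) * q * ζ ^ p) * hs2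
  -- take norms: `|b| (q - p) = p + q`
  have hnorm := congrArg (fun z : ℂ => ‖z‖) hkey
  simp only [norm_mul, norm_neg, norm_pow, hζ1, one_pow, mul_one, Complex.norm_intCast,
    Complex.norm_natCast] at hnorm
  have hqp : ‖((q : ℂ) - p)‖ = ((q - p : ℕ) : ℝ) := by
    rw [show ((q : ℂ) - p) = ((q - p : ℕ) : ℂ) by rw [Nat.cast_sub hpq.le], Complex.norm_natCast]
  have hs1 : |(s : ℝ)| = 1 := by rcases hs with h | h <;> simp [h]
  have hb' : (b.natAbs : ℝ) = |(b : ℝ)| := by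
    rw [Nat.cast_natAbs, Int.cast_abs]
  rw [hqp, hs1, one_mul, ← hb'] at hnorm
  exact_mod_cast hnorm.symm

/-- **Cyclotomic part vs. cyclotomic-free part** (`|b| ≥ 3`, outside the family `n = |b| k`): the
quadrinomial factors as `P = C · Q` with `Q` cyclotomic-free and `C ∣ x^{q-p} + s`, `C ∣ x^{2p} - 1`.
(Peel cyclotomic factors one at a time; each new `Φ_r` divides `x^{q-p} + s` and `x^{2p} - 1`, is prime,
and does not divide the part already peeled — else `Φ_r² ∣ P`.) -/
theorem exists_cyclotomicFree_factor_quadrinomial (hp : 0 < p) (hpq : p < q) (hs : s = 1 ∨ s = -1)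
    (hb : 3 ≤ |b|) (hgen : p + q ≠ b.natAbs * (q - p)) :
    ∃ Cy Q : ℤ[X], (X ^ (p + q) + C b * X ^ p + C (s * b) * X ^ q + C s : ℤ[X]) = Cy * Q ∧
      Cy ∣ (X ^ (q - p) + C s : ℤ[X]) ∧ Cy ∣ (X ^ (2 * p) - 1 : ℤ[X]) ∧
      (∀ k : ℕ, 0 < k → ¬ cyclotomic k ℤ ∣ Q) := by
  set P : ℤ[X] := X ^ (p + q) + C b * X ^ p + C (s * b) * X ^ q + C s with hP
  have hP0 : P ≠ 0 := (quadrinomial_monic_natDegree hp hpq b s).1.ne_zero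
  -- peeling, by strong induction on the degree of the remaining factor
  have key : ∀ d : ℕ, ∀ Cy Q : ℤ[X], Q.natDegree = d → P = Cy * Q →
      Cy ∣ (X ^ (q - p) + C s : ℤ[X]) → Cy ∣ (X ^ (2 * p) - 1 : ℤ[X]) →
      ∃ Cy' Q' : ℤ[X], P = Cy' * Q' ∧ Cy' ∣ (X ^ (q - p) + C s : ℤ[X]) ∧ Cy' ∣ (X ^ (2 * p) - 1 : ℤ[X]) ∧
        (∀ k : ℕ, 0 < k → ¬ cyclotomic k ℤ ∣ Q') := by
    intro d
    induction d using Nat.strong_induction_on with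
    | _ d ih =>
      intro Cy Q hd hPQ hCyW hCyV
      by_cases hcf : ∀ k : ℕ, 0 < k → ¬ cyclotomic k ℤ ∣ Q
      · exact ⟨Cy, Q, hPQ, hCyW, hCyV, hcf⟩
      push Not at hcf
      obtain ⟨m, hm, hmQ⟩ := hcf
      obtain ⟨R, hR⟩ := hmQ
      have hQ0 : Q ≠ 0 := by rintro rfl; rw [mul_zero] at hPQ; exact hP0 hPQ
      have hR0 : R ≠ 0 := by rintro rfl; rw [mul_zero] at hR; exact hQ0 hR
      have hΦ0 : cyclotomic m ℤ ≠ 0 := cyclotomic_ne_zero m ℤ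
      have hmP : cyclotomic m ℤ ∣ P := ⟨Cy * R, by rw [hPQ, hR]; ring⟩
      have hmW := cyclotomic_dvd_X_pow_add_of_dvd_quadrinomial hp hpq hs hb hm hmP
      have hmV := (cyclotomic_dvd_X_pow_sub_one_of_dvd_quadrinomial hp hpq hs hb hm hmP).2
      -- `Φ_m ∤ Cy` (else `Φ_m² ∣ P`)
      have hprime : Prime (cyclotomic m ℤ) := (cyclotomic.irreducible hm).prime
      have hnCy : ¬ cyclotomic m ℤ ∣ Cy := by
        intro h
        obtain ⟨Cy', hCy'⟩ := h
        have h2 : cyclotomic m ℤ * cyclotomic m ℤ ∣ P := ⟨Cy' * R, by rw [hPQ, hR, hCy']; ring⟩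
        exact hgen (eq_natAbs_mul_of_cyclotomic_sq_dvd_quadrinomial hp hpq hs hb hm h2)
      -- new cyclotomic part `Cy * Φ_m` still divides `W` and `V`
      have hdvdW : Cy * cyclotomic m ℤ ∣ (X ^ (q - p) + C s : ℤ[X]) := by
        obtain ⟨W', hW'⟩ := hCyW
        have : cyclotomic m ℤ ∣ W' := by
          rcases hprime.dvd_or_dvd (hW' ▸ hmW) with h | h
          · exact absurd h hnCy
          · exact h
        rw [hW']; exact mul_dvd_mul_left Cy this
      have hdvdV : Cy * cyclotomic m ℤ ∣ (X ^ (2 * p) - 1 : ℤ[X]) := by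
        obtain ⟨V', hV'⟩ := hCyV
        have : cyclotomic m ℤ ∣ V' := by
          rcases hprime.dvd_or_dvd (hV' ▸ hmV) with h | h
          · exact absurd h hnCy
          · exact h
        rw [hV']; exact mul_dvd_mul_left Cy this
      have hdR : R.natDegree < d := by
        rw [← hd, hR, natDegree_mul hΦ0 hR0, natDegree_cyclotomic]
        have := Nat.totient_pos.mpr hm
        omega
      exact ih R.natDegree hdR (Cy * cyclotomic m ℤ) R rfl (by rw [hPQ, hR]; ring) hdvdW hdvdV
  exact key P.natDegree 1 P rfl (one_mul P).symm (one_dvd _) (one_dvd _)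

/-- **`|b| ≤ 2 M(P)²`, unconditionally**, for the quadrinomial `P = x^{p+q} + b x^p + s b x^q + s` with
`|b| ≥ 3` outside the family `p + q = |b| (q - p)` (`0 < p < q`, `s = ±1`): write `P = C · Q` as above;
`M(C) = 1` (`C ∣ x^{2p} - 1`), `deg C ≤ min(q - p, 2p)` so `2 deg Q ≥ p + q = n`, and the resultant step
gives `|b|^{deg Q} ≤ 2^{deg Q} M(Q)ⁿ`; hence `(|b|/2)ⁿ ≤ (|b|/2)^{2 deg Q} ≤ M^{2n}`. -/
theorem abs_le_two_mul_measure_sq_quadrinomial (hp : 0 < p) (hpq : p < q) (hs : s = 1 ∨ s = -1)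
    (hb : 3 ≤ |b|) (hgen : p + q ≠ b.natAbs * (q - p)) :
    (|b| : ℝ) ≤ 2 * intMahlerMeasure (X ^ (p + q) + C b * X ^ p + C (s * b) * X ^ q + C s : ℤ[X]) ^ 2 := by
  obtain ⟨hmon, hdeg⟩ := quadrinomial_monic_natDegree hp hpq b s
  obtain ⟨Cy, Q, hPQ, hCyW, hCyV, hcfQ⟩ := exists_cyclotomicFree_factor_quadrinomial hp hpq hs hb hgen
  set P : ℤ[X] := X ^ (p + q) + C b * X ^ p + C (s * b) * X ^ q + C s with hP
  set n := p + q with hn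
  have hP0 : P ≠ 0 := hmon.ne_zero
  have hCy0 : Cy ≠ 0 := by rintro rfl; rw [zero_mul] at hPQ; exact hP0 hPQ
  have hQ0 : Q ≠ 0 := by rintro rfl; rw [mul_zero] at hPQ; exact hP0 hPQ
  -- degrees: `deg Cy ≤ min(q - p, 2p)`, so `2 deg Q ≥ n`
  have hW0 : (X ^ (q - p) + C s : ℤ[X]) ≠ 0 := (monic_X_pow_add_C s (by omega)).ne_zero
  have hV0 : (X ^ (2 * p) - 1 : ℤ[X]) ≠ 0 := by
    rw [← C_1]; exact X_pow_sub_C_ne_zero (by omega) 1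
  have hCy1 : Cy.natDegree ≤ q - p := by
    have := natDegree_le_of_dvd hCyW hW0; rwa [natDegree_X_pow_add_C] at this
  have hCy2 : Cy.natDegree ≤ 2 * p := by
    have := natDegree_le_of_dvd hCyV hV0; rwa [← C_1, natDegree_X_pow_sub_C] at this
  have hdegs : Cy.natDegree + Q.natDegree = n := by
    rw [← hdeg, hPQ, natDegree_mul hCy0 hQ0]
  have hQn : n ≤ 2 * Q.natDegree := by omega
  -- `M(Cy) = 1`, so `M(Q) = M(P)`
  have hMCy : intMahlerMeasure Cy = 1 := by
    obtain ⟨V', hV'⟩ := hCyV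
    exact intMahlerMeasure_eq_one_of_mul_eq_X_pow_sub_one (by omega : 0 < 2 * p) hV'.symm
  have hMQ : intMahlerMeasure Q = intMahlerMeasure P := by
    rw [hPQ, intMahlerMeasure_mul, hMCy, one_mul]
  -- resultant step on `Q` with `G = xⁿ + s = C b * (-(X^p + C s * X^q)) + Q * Cy`
  have hG : (X ^ n + C s : ℤ[X]) = C b * (-(X ^ p + C s * X ^ q)) + Q * Cy := by
    rw [mul_comm Q Cy, ← hPQ, hP, map_mul]; ring
  have hGdeg : (X ^ n + C s : ℤ[X]).natDegree ≤ n := by rw [natDegree_X_pow_add_C]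
  have hne : Q.resultant (X ^ n + C s) Q.natDegree n ≠ 0 := by
    refine resultant_ne_zero_of_cyclotomicFree (L := 2 * n) hQ0 hcfQ hGdeg (by omega) ?_
    intro z hz
    simp only [Polynomial.map_add, Polynomial.map_pow, map_X, eq_intCast, Polynomial.map_intCast,
      eval_add, eval_pow, eval_X, eval_intCast] at hz
    have hz' : z ^ n = -(s : ℂ) := eq_neg_of_add_eq_zero_left hz
    rw [pow_mul', hz', neg_sq]
    rcases hs with h | h <;> simp [h]
  have hroot : ∀ α : ℂ, ‖((X ^ n + C s : ℤ[X]).map (Int.castRingHom ℂ)).eval α‖ ≤ 2 * max 1 ‖α‖ ^ n := by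
    intro α
    simp only [Polynomial.map_add, Polynomial.map_pow, map_X, eq_intCast, Polynomial.map_intCast,
      eval_add, eval_pow, eval_X, eval_intCast]
    exact norm_pow_add_le_two_mul α (s : ℂ) (norm_intCast_le_one_of_sign hs) n
  have h := abs_pow_le_pow_mul_measure_pow_of_resultant (K := 2) hG (by omega) hGdeg hne hroot
  rw [hMQ] at h
  -- `(|b|/2)^{deg Q} ≤ Mⁿ`, `|b|/2 ≥ 1`, `2 deg Q ≥ n` ⇒ `(|b|/2)ⁿ ≤ M^{2n}`
  set M := intMahlerMeasure P with hM
  have hM1 : 1 ≤ M := one_le_intMahlerMeasure hP0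
  have hb2 : (1 : ℝ) ≤ |(b : ℝ)| / 2 := by
    have : (3 : ℝ) ≤ |(b : ℝ)| := by exact_mod_cast hb
    linarith
  have h1 : (|(b : ℝ)| / 2) ^ Q.natDegree ≤ M ^ n := by
    have h2 : (0 : ℝ) < 2 ^ Q.natDegree := by positivity
    rw [div_pow, div_le_iff₀ h2]
    calc |(b : ℝ)| ^ Q.natDegree ≤ 2 ^ Q.natDegree * M ^ n := by exact_mod_cast h
      _ = M ^ n * 2 ^ Q.natDegree := by ring
  have h3 : (|(b : ℝ)| / 2) ^ n ≤ (M ^ 2) ^ n := by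
    calc (|(b : ℝ)| / 2) ^ n ≤ (|(b : ℝ)| / 2) ^ (2 * Q.natDegree) := pow_le_pow_right₀ hb2 hQn
      _ = ((|(b : ℝ)| / 2) ^ Q.natDegree) ^ 2 := by rw [mul_comm, pow_mul]
      _ ≤ (M ^ n) ^ 2 := pow_le_pow_left₀ (by positivity) h1 2
      _ = (M ^ 2) ^ n := by rw [← pow_mul, ← pow_mul, mul_comm]
  have h4 : |(b : ℝ)| / 2 ≤ M ^ 2 := le_of_pow_le_pow_left₀ (by omega : n ≠ 0) (by positivity) h3
  linarith

/-- **No quadrinomial `x^{p+q} + b x^p + s b x^q + s` with `|b| ≥ 3` and `p + q ≠ |b| (q - p)` is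
sub-Lehmer** — with or without cyclotomic factors: `M² ≥ |b|/2 ≥ 3/2`, `M ≥ 1.2247 > 1.17629 > M(ℓ)`. -/
theorem not_subLehmer_quadrinomial_of_three_le_abs (hp : 0 < p) (hpq : p < q) (hs : s = 1 ∨ s = -1)
    (hb : 3 ≤ |b|) (hgen : p + q ≠ b.natAbs * (q - p)) :
    ¬ SubLehmer (X ^ (p + q) + C b * X ^ p + C (s * b) * X ^ q + C s : ℤ[X]) := by
  intro hsub
  have h := abs_le_two_mul_measure_sq_quadrinomial hp hpq hs hb hgen
  have hL := lehmer_measure_upper_bound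
  obtain ⟨h1, h2⟩ := hsub
  set M := intMahlerMeasure (X ^ (p + q) + C b * X ^ p + C (s * b) * X ^ q + C s : ℤ[X])
  have h3 : (3 : ℝ) ≤ 2 * M ^ 2 := le_trans (by exact_mod_cast hb) h
  have hM : M < 117629 / 100000 := by linarith
  have hM0 : 0 ≤ M := by linarith
  nlinarith

end Quadrinomial

end Summit.Ventures.DiscreteObjects.Mahler
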